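import Literature.MathematicalPhysics.QuantumFieldTheory.Balaban1983to89.B5Hk163RDiv

/-!
# Bałaban [B5] p. 29, (1.47) ⟹ (1.64): «We make the translation A = A′ + H_kB» — the constrained
# Gaussian integral of the k-fold renormalization transformation FACTORISES through the minimiser
# `H_kB`, for the typed torus operator `B5Hk163Torus.HkOp` (kernel; cell `pub-balaban`, PAPER SUB-CELL B05)

**Source (verbatim; quotations LOCATE the statements — nothing printed is used as a hypothesis).**
[B5] = T. Bałaban, *Propagators and renormalization transformations for lattice gauge theories. I*,
Commun. Math. Phys. **95** (1984) 17–40 [`Balaban1984PropagatorsI`]; renders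
`b2b-balaban-ref1/pages/1984-cmp95-propagators-rt-I/…-p010-x2.png` (p. 26) and `…-p013-x2.png` (p. 29),
READ AS IMAGES by this unit.
* p. 26 [PDF 10]: «We have to calculate the integral
  ((ST)^k e^{−S})(B) = z′^{(k)}∣det(Δ↾_{N(Q_k)})∣∫dA δ(B − Q_kA)δ_R(∂*A) exp(−½⟨∂A, ∂A⟩). (1.47)
  With this integral an operator of fundamental importance is connected. It is defined on configurations B
  on the lattice T₁^{(k)} and its value on such a configuration is equal to a configuration A on T_η
  minimizing the form ½⟨∂A, ∂A⟩ under the conditions Q_kA = B, R∂*A = 0.»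
* p. 29 [PDF 13]: «Using (1.60), or better (1.63), we can verify all the properties of H_kB: Q_kH_kB = B,
  R∂*H_kB = 0, H_kB is a minimum of ½⟨∂A, ∂A⟩ on the hyperplane {A : Q_kA = B, R∂*A = 0}, which means
  that ⟨∂A′, ∂H_kB⟩ = 0 on the subspace {A′ : Q_kA′ = 0, R∂*A′ = 0}.
  Let us now come back to the integral (1.47). We make the translation A = A′ + H_kB and using the above
  properties of H_kB, we get ((ST)^k e^{−S})(B) = Z_k exp(−½⟨∂H_kB, ∂H_kB⟩). (1.64)
  The action Δ_k is thus defined by ⟨B, Δ_kB⟩ = ⟨∂H_kB, ∂H_kB⟩. (1.65)»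
* p. 25 [PDF 9] (render `…-p009-x2.png`, read as image) — the paper's own reading of the δ-functions of
  (1.47): «∫dλ δ(Q′_kλ) exp(−(1/2α)‖Δλ‖²) = ∫_{N(Q′_k)} dλ exp(−(1/2α)‖Δλ‖²) = ∣det(Δ⁻¹↾_R)∣∫_R dλ exp(−(1/2α)‖λ‖²),
  (1.40)» (a δ-function of linear constraints = the flat measure of the constraint subspace) and, after
  «𝒢_α(∂*A) ⟶_{α→0} ∣det(Δ↾_{N(Q′_k)})∣δ_R(∂*A), (1.41)»: «where δ_R is a δ-function concentrated at the origin
  of the sub-space R.»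
* p. 29 [PDF 13], bottom (v1.1, §5): «The integral (1.47) can be written in the following way
  ((ST)^k exp(−S))(B) = z′^{(k)}∣det(Δ↾_{N(Q_k)})∣∫dAδ(B − Q_kA)δ_R(∂*A)·exp[−½⟨∂A, ∂A⟩ − ½‖R∂*A‖² − ½a‖B − Q_kA‖²].
  (1.68) The additional terms vanish because of the delta-functions. The quadratic form in the fields A in
  the exponential is equal to ⟨A, Δ_aA⟩ = ⟨A, ∂*∂A⟩ + ⟨A, ∂R∂*A⟩ + a⟨A, Q*QA⟩ = ⟨A, ΔA⟩ − ⟨A, ∂P∂*A⟩ + a⟨A, Q*QA⟩,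
  (1.69) Δ = ∂*∂ + ∂∂*, R = I − P,».

**Typed objects (all from the tree; torus model `T_η`, `η = L^{−k}`, `n = L^k`, fine torus `fine n M`,
unit torus `Tor M`, `d` directions).**  `HkOp n M` = the operator `H_k` of (1.63) (`B5Hk163Torus`);
`QvOp n M` = `Q_k` on vector fields (`B5Block118`); `R∂*A = (1 − PcT)·(GradOp)ᴴ A` (`B5Value126.PcT` = the
projection `P` of (1.44), `B5Action121.GradOp` = `∂`); `DstarD n M = Δ − ∂∂* = ∂*∂` (`B5Hk163RDiv`, (1.69)), with
`⟨A, ∂*∂A⟩ = ½Σ_{x,μ,ν}|F_{μν}[A](x)|²` (`B5Hk163RDiv.form_DstarD`, (1.21)).  «The above properties of H_kB»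
ARE KERNEL THEOREMS of the tree: `B5Hk163Torus.QvOp_HkOp_mulVec` (Q_kH_kB = B), `B5Hk163RDiv.R_divS_HkOp`
(R∂*H_kB = 0), `B5Hk163RDiv.curl_HkOp_orthogonal` / `form_DstarD_decomp` (⟨∂A′, ∂H_kB⟩ = 0 on N(Q_k)),
`B5Hk163RDiv.HkOp_minimum_unique`.

**What is proved here (zero `sorry`).**
* §1 `cEnergy A := Re⟨A, ∂*∂A⟩ = ½Σ|F_{μν}[A]|²` (the exponent «½⟨∂A, ∂A⟩» up to the (1.21) weight, absorbed
  below in a free constant `c`); `Fib B` := the printed hyperplane `{A : Q_kA = B, R∂*A = 0}`; **the translation**: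
  `A′ + H_kB ∈ Fib B ↔ A′ ∈ Fib 0` (`add_HkOp_mem_Fib_iff`; the `Equiv` `translEquiv`), and **the energy
  splitting** `cEnergy (A′ + H_kB) = cEnergy A′ + cEnergy (H_kB)` for EVERY `A′ ∈ N(Q_k)` (`cEnergy_transl`;
  the gauge condition is not needed for it) — this is «using the above properties of H_kB».
* §2 **WHY `δ_R`**: on the printed subspace `Fib 0 = {A′ : Q_kA′ = 0, R∂*A′ = 0}` the curvature form is
  POSITIVE DEFINITE, `A′ ≠ 0 → 0 < cEnergy A′` (`cEnergy_pos_of_mem_Fib_zero`; from «Δ_a is a positive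
  operator» p. 30, tree `B5DeltaA169.DeltaA_posDef`, and `B5Hk163RDiv.DeltaA_mulVec_eq_DstarD_mulVec`):
  the gauge δ-function removes exactly the degenerate directions `A′ = ∂λ` of `⟨∂A′, ∂A′⟩`.
* §3 **(1.64)**.  The δ-measure `dA δ(B − Q_kA)δ_R(∂*A)` of the hyperplane `Fib B` is TYPED, following the
  paper's (1.40) and the tree's `B9Eq320Gauss` (b09), as the image under the printed translation
  `A′ ↦ A′ + H_kB` of a measure carried by `N(Q_k)`: a parameter space `W` with a measure `μ` and a
  parametrisation `ι : W → (fine fields)` with `Q_k(ι w) = 0` (hypothesis `hι`; `ι` INTO `Fib 0` is the printed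
  case, only `Q_kι = 0` is used).  Then for every real `c`:
  `int147 c B := ∫ exp(−c·cEnergy(ι w + H_kB)) dμ(w) = Zint c · exp(−c·cEnergy(H_kB))` (`int147_eq` = (1.64) with
  `Z_k = z′^{(k)}∣det(Δ↾_{N(Q_k)})∣·Zint`, `Zint := ∫ exp(−c·cEnergy(ι w)) dμ(w) = int147 c 0` manifestly
  independent of `B`; `rt147_eq_164` carries the free prefactor).  Mathlib's Bochner `∫` needs NO integrability
  for this (a constant factor commutes with `∫` unconditionally).  `int147_base_indep`: with `μ` right-invariant
  and `ι` additive, translating by ANY point `A₀` of the hyperplane with `A₀ − H_kB ∈ range ι` gives the same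
  integral (the typing does not depend on the choice of `H_kB` as base point).
* §4 **CONVERGENCE, 0 < Z_k < ∞** for the flat measure: `W = EuclideanSpace ℝ (Fin m)` with Lebesgue `volume`,
  `ι` an INJECTIVE `ℝ`-linear parametrisation of (part of) `Fib 0`, `c > 0`: `w ↦ exp(−c·cEnergy(ι w))` is
  integrable and `0 < Zint`, `0 < int147 c B` (`integrable_gauss`, `Zint_pos`, `int147_pos`) — by §2 and
  compactness of the unit sphere (`exists_sq_norm_le_cEnergy`: `m₀‖w‖² ≤ cEnergy(ι w)`, `m₀ > 0`), dominated by
  Mathlib's Gaussian `GaussianFourier.integral_rexp_neg_mul_sq_norm`.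
* §5 (v1.1) **(1.68)/(1.69)**: the typed (1.68) exponent `E168 a B A := cEnergy A + Σ_x|(R∂*A)(x)|² +
  a·n^d·Σ_y|(B − Q_kA)(y)|²` (unweighted sums; `Q*_k = n^d(Q_k)ᴴ` as in `B5DeltaA169`); «the additional terms
  vanish because of the delta-functions»: `A ∈ Fib B → E168 a B A = cEnergy A` (`E168_eq_cEnergy_of_mem_Fib`),
  hence (1.68) = (1.47) = (1.64) as typed integrals (`int168_eq_int147`, `int168_eq_164`); (1.69) first line in
  matrix form `Aᴴ·Δ_aA = Aᴴ·∂*∂A + (R∂*A)ᴴ·(R∂*A) + a·n^d·(Q_kA)ᴴ·(Q_kA)` with the tree's `Δ_a = B5DeltaA169.DeltaA`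
  (`form_DeltaA_169`, via `⟨A, ∂R∂*A⟩ = ‖R∂*A‖²`, `form_dRd`, `R` an orthogonal projection); «the quadratic form in
  the fields A in the exponential is equal to ⟨A, Δ_aA⟩»: `E168 a B A = Re⟨A, Δ_aA⟩ − 2a·n^d·Re⟨B, Q_kA⟩ +
  a·n^d·Σ|B|²` (`E168_eq_form_DeltaA`), and `Re⟨A, Δ_aA⟩ > 0` for `A ≠ 0`, `a > 0` (`re_form_DeltaA_pos`, tree
  `DeltaA_posDef`).

HONEST SCOPE.  (i) The identification of `((ST)^k e^{−S})(B)` with the integral (1.47) — the k-fold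
renormalization transformation (1.17), the passage from the axial to the Landau gauge (1.23)/(1.46) — is NOT
typed here (it is the t4/B6 side of the cell; GAPS G-B5-01R covers (1.17) ⇒ (1.23) abstractly); the prefactor
`z′^{(k)}∣det(Δ↾_{N(Q_k)})∣` stays FREE (`pref`).  (ii) The δ-measure is typed by its defining property
(translate of a measure carried by the constraint subspace), exactly as B5 (1.40) reads `∫dλ δ(Q′_kλ)(…)`; no
disintegration theorem is claimed.  (iii) Torus model, `U = 1` (the paper's own setting in Sect. 1).
(iv) Value = kernel certificate of the bookkeeping step (1.47) ⟹ (1.64) given the properties of `H_kB` (which are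
tree theorems), plus the positivity that makes `Z_k` finite and non-zero; NOT summit progress.  (v) (§5) the
(1.68)/(1.69) identities are proved for the UNWEIGHTED forms (common factor `½η^d` absorbed in `c`), with the second
line of (1.69) being the tree's DEFINITION of `Δ_a` (`B5DeltaA169.DeltaA_mulVec`); Sect. E itself ((1.70) ff.) is
the tree's `B5DeltaA169` / `Beta.FluctuationProjection`, not this module.

ABSOLUTE-RULE CENSUS: every theorem below is proved outright from the tree modules named above and Mathlib
(sorry-free; axioms `propext`, `Classical.choice`, `Quot.sound` only); no quoted statement is used as a
hypothesis.  Unit `b2b-balaban-b05-g12` (planner, PAPER SUB-CELL B05 gen 12; journal claim HK164-TRANSL;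
GAPS G-b05g12-1∞).  Version: v1.1 — §5 APPENDED (claim HK168-AUX); every v1 declaration (p189013, commit
ff49c2e9aee2) is byte-identical.
-/

open scoped BigOperators Matrix ComplexConjugate
open Finset Complex MeasureTheory

namespace Literature.MathematicalPhysics.QuantumFieldTheory.Balaban1983to89.B5Hk164Transl

open Literature.MathematicalPhysics.QuantumFieldTheory.Balaban1983to89
open Literature.MathematicalPhysics.QuantumFieldTheory.Balaban1983to89.B5Hk163RDiv (DstarD form_DstarD
  form_DstarD_decomp R_divS_HkOp DeltaA_mulVec_eq_DstarD_mulVec HkOp_minimum)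
open Literature.MathematicalPhysics.QuantumFieldTheory.Balaban1983to89.B5Prop11Plancherel (Tor fine)
open Literature.MathematicalPhysics.QuantumFieldTheory.Balaban1983to89.B5Action121 (GradOp Fs)
open Literature.MathematicalPhysics.QuantumFieldTheory.Balaban1983to89.B5Block118 (QvOp)
open Literature.MathematicalPhysics.QuantumFieldTheory.Balaban1983to89.B5Hk163Torus (HkOp QvOp_HkOp_mulVec)
open Literature.MathematicalPhysics.QuantumFieldTheory.Balaban1983to89.B5Value126 (PcT)
open Literature.MathematicalPhysics.QuantumFieldTheory.Balaban1983to89.B5DeltaA169 (DeltaA DeltaA_posDef)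

noncomputable section

variable {d : ℕ}

/-! ## §1  The exponent, the hyperplane, the translation `A = A′ + H_kB` -/

section Energy

open Matrix

variable (n : ℕ) [NeZero n] (M : Fin d → ℕ) [hM : ∀ μ, NeZero (M μ)]

/-- The exponent of (1.47) up to its constant: `cEnergy A := Re⟨A, ∂*∂A⟩ = ½Σ_{x,μ,ν}|F_{μν}[A](x)|²`
(`B5Hk163RDiv.DstarD`, `form_DstarD`; «½⟨∂A, ∂A⟩» of (1.47) with (1.21)).
[cite: Balaban1984PropagatorsI, (1.47) p.26, (1.21) p.21] -/
def cEnergy (A : Tor (fine n M) × Fin d → ℂ) : ℝ :=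
  (star A ⬝ᵥ (DstarD n M *ᵥ A)).re

/-- `cEnergy A = ½Σ_{x,μ,ν}|F_{μν}[A](x)|²`. [cite: Balaban1984PropagatorsI, (1.21) p.21] -/
theorem cEnergy_eq (A : Tor (fine n M) × Fin d → ℂ) :
    cEnergy n M A = (1 / 2 : ℝ) * ∑ x, ∑ μ, ∑ ν, ‖Fs (fine n M) (n : ℂ) A μ ν x‖ ^ 2 := by
  rw [cEnergy, form_DstarD, Complex.ofReal_re]

/-- the complex form `⟨A, ∂*∂A⟩` is the real number `cEnergy A`. [folklore] -/
theorem form_eq_cEnergy (A : Tor (fine n M) × Fin d → ℂ) :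
    star A ⬝ᵥ (DstarD n M *ᵥ A) = ((cEnergy n M A : ℝ) : ℂ) := by
  rw [cEnergy_eq, form_DstarD]

/-- `0 ≤ cEnergy A`. [folklore] -/
theorem cEnergy_nonneg (A : Tor (fine n M) × Fin d → ℂ) : 0 ≤ cEnergy n M A := by
  rw [cEnergy_eq]
  positivity

/-- `cEnergy 0 = 0`. [folklore] -/
@[simp] theorem cEnergy_zero : cEnergy n M 0 = 0 := by
  simp [cEnergy]

/-- homogeneity: `cEnergy (t•A) = t²·cEnergy A` for real `t`. [folklore] -/
theorem cEnergy_smul (t : ℝ) (A : Tor (fine n M) × Fin d → ℂ) :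
    cEnergy n M (t • A) = t ^ 2 * cEnergy n M A := by
  have ht : t • A = ((t : ℂ)) • A := by
    funext x
    simp [Pi.smul_apply, Complex.real_smul]
  rw [cEnergy, cEnergy, ht, star_smul, Matrix.mulVec_smul, smul_dotProduct, dotProduct_smul,
    Complex.star_def, Complex.conj_ofReal, smul_eq_mul, smul_eq_mul, ← mul_assoc, ← Complex.ofReal_mul,
    Complex.re_ofReal_mul, sq]

/-- **the printed hyperplane** `{A : Q_kA = B, R∂*A = 0}` (p. 26 «under the conditions Q_kA = B, R∂*A = 0»;
p. 29); `Fib 0` is the printed subspace `{A′ : Q_kA′ = 0, R∂*A′ = 0}`.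
[cite: Balaban1984PropagatorsI, (1.47) p.26, p.29 (text)] -/
def Fib (B : Tor M × Fin d → ℂ) : Set (Tor (fine n M) × Fin d → ℂ) :=
  {A | QvOp n M *ᵥ A = B ∧ (1 - PcT n M (n : ℂ)) *ᵥ ((GradOp (fine n M) (n : ℂ))ᴴ *ᵥ A) = 0}

/-- membership unfolding. [folklore] -/
theorem mem_Fib_iff (B : Tor M × Fin d → ℂ) (A : Tor (fine n M) × Fin d → ℂ) :
    A ∈ Fib n M B ↔
      QvOp n M *ᵥ A = B ∧ (1 - PcT n M (n : ℂ)) *ᵥ ((GradOp (fine n M) (n : ℂ))ᴴ *ᵥ A) = 0 :=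
  Iff.rfl

/-- «Q_kH_kB = B, R∂*H_kB = 0»: `H_kB` lies on the hyperplane (tree theorems `QvOp_HkOp_mulVec`,
`R_divS_HkOp`). [cite: Balaban1984PropagatorsI, p.29 (text)] -/
theorem HkOp_mem_Fib (B : Tor M × Fin d → ℂ) : HkOp n M *ᵥ B ∈ Fib n M B :=
  ⟨QvOp_HkOp_mulVec n M B, R_divS_HkOp n M B⟩

/-- `0 ∈ Fib 0`. [folklore] -/
theorem zero_mem_Fib_zero : (0 : Tor (fine n M) × Fin d → ℂ) ∈ Fib n M 0 := by
  simp [mem_Fib_iff]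

/-- **THE TRANSLATION «A = A′ + H_kB»**: `A′ + H_kB` lies on the hyperplane `{Q_kA = B, R∂*A = 0}` iff `A′`
lies on the subspace `{Q_kA′ = 0, R∂*A′ = 0}`. [cite: Balaban1984PropagatorsI, p.29 «We make the translation
A = A′ + H_kB»] -/
theorem add_HkOp_mem_Fib_iff (B : Tor M × Fin d → ℂ) (A' : Tor (fine n M) × Fin d → ℂ) :
    A' + HkOp n M *ᵥ B ∈ Fib n M B ↔ A' ∈ Fib n M 0 := by
  obtain ⟨hQ, hR⟩ := HkOp_mem_Fib n M B
  simp only [mem_Fib_iff, Matrix.mulVec_add, hQ, hR, add_zero]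
  constructor
  · rintro ⟨h1, h2⟩
    exact ⟨by simpa using h1, h2⟩
  · rintro ⟨h1, h2⟩
    exact ⟨by rw [h1, zero_add], h2⟩

/-- the same, read from the hyperplane: `A ∈ Fib B ↔ A − H_kB ∈ Fib 0`. [cite: Balaban1984PropagatorsI,
p.29 (text)] -/
theorem mem_Fib_iff_sub (B : Tor M × Fin d → ℂ) (A : Tor (fine n M) × Fin d → ℂ) :
    A ∈ Fib n M B ↔ A - HkOp n M *ᵥ B ∈ Fib n M 0 := by
  rw [← add_HkOp_mem_Fib_iff n M B (A - HkOp n M *ᵥ B), sub_add_cancel]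

/-- the translation as a bijection `Fib 0 ≃ Fib B`, `A′ ↦ A′ + H_kB`, inverse `A ↦ A − H_kB`.
[cite: Balaban1984PropagatorsI, p.29 «We make the translation A = A′ + H_kB»] -/
def translEquiv (B : Tor M × Fin d → ℂ) : Fib n M 0 ≃ Fib n M B where
  toFun A' := ⟨A'.1 + HkOp n M *ᵥ B, (add_HkOp_mem_Fib_iff n M B A'.1).mpr A'.2⟩
  invFun A := ⟨A.1 - HkOp n M *ᵥ B, (mem_Fib_iff_sub n M B A.1).mp A.2⟩
  left_inv A' := by
    ext1
    simp
  right_inv A := by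
    ext1
    simp

/-- `translEquiv` is the printed translation. [folklore] -/
@[simp] theorem translEquiv_apply (B : Tor M × Fin d → ℂ) (A' : Fib n M 0) :
    ((translEquiv n M B A' : Fib n M B) : Tor (fine n M) × Fin d → ℂ) = A'.1 + HkOp n M *ᵥ B := rfl

/-- **«using the above properties of H_kB»** — the ENERGY SPLITTING under the translation, complex form:
`⟨A′ + H_kB, ∂*∂(A′ + H_kB)⟩ = ⟨A′, ∂*∂A′⟩ + ⟨H_kB, ∂*∂H_kB⟩` for every `A′ ∈ N(Q_k)` (the cross terms are
«⟨∂A′, ∂H_kB⟩ = 0», tree `B5Hk163RDiv.form_DstarD_decomp`; the gauge condition is not needed).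
[cite: Balaban1984PropagatorsI, p.29 (text)] -/
theorem form_transl (B : Tor M × Fin d → ℂ) (A' : Tor (fine n M) × Fin d → ℂ) (hA' : QvOp n M *ᵥ A' = 0) :
    star (A' + HkOp n M *ᵥ B) ⬝ᵥ (DstarD n M *ᵥ (A' + HkOp n M *ᵥ B))
      = star A' ⬝ᵥ (DstarD n M *ᵥ A') + star (HkOp n M *ᵥ B) ⬝ᵥ (DstarD n M *ᵥ (HkOp n M *ᵥ B)) := by
  have hA : QvOp n M *ᵥ (A' + HkOp n M *ᵥ B) = B := by
    rw [Matrix.mulVec_add, hA', QvOp_HkOp_mulVec, zero_add]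
  rw [form_DstarD_decomp n M B (A' + HkOp n M *ᵥ B) hA, add_sub_cancel_right]

/-- **ENERGY SPLITTING**: `cEnergy (A′ + H_kB) = cEnergy A′ + cEnergy (H_kB)` for every `A′` with `Q_kA′ = 0`.
[cite: Balaban1984PropagatorsI, p.29 (text)] -/
theorem cEnergy_transl (B : Tor M × Fin d → ℂ) (A' : Tor (fine n M) × Fin d → ℂ)
    (hA' : QvOp n M *ᵥ A' = 0) :
    cEnergy n M (A' + HkOp n M *ᵥ B) = cEnergy n M A' + cEnergy n M (HkOp n M *ᵥ B) := by
  rw [cEnergy, form_transl n M B A' hA', Complex.add_re, cEnergy, cEnergy]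

/-- in particular `cEnergy (H_kB) ≤ cEnergy (A′ + H_kB)`: the minimum property on the translated hyperplane
(tree `B5Hk163RDiv.HkOp_minimum`). [cite: Balaban1984PropagatorsI, p.29 «H_kB is a minimum of ½⟨∂A, ∂A⟩ on
the hyperplane {A : Q_kA = B, R∂*A = 0}»] -/
theorem cEnergy_HkOp_le (B : Tor M × Fin d → ℂ) (A' : Tor (fine n M) × Fin d → ℂ)
    (hA' : QvOp n M *ᵥ A' = 0) :
    cEnergy n M (HkOp n M *ᵥ B) ≤ cEnergy n M (A' + HkOp n M *ᵥ B) := by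
  rw [cEnergy_transl n M B A' hA']
  linarith [cEnergy_nonneg n M A']

end Energy

/-! ## §2  Why `δ_R`: positivity of the curvature form on `{Q_kA′ = 0, R∂*A′ = 0}` -/

section Positivity

open Matrix
open scoped ComplexOrder

variable (n : ℕ) [NeZero n] (M : Fin d → ℕ) [hM : ∀ μ, NeZero (M μ)]

/-- **POSITIVE DEFINITENESS ON THE GAUGE-FIXED SUBSPACE**: for `A′ ∈ {Q_kA′ = 0, R∂*A′ = 0}`, `A′ ≠ 0`,
`0 < cEnergy A′ = ½Σ|F_{μν}[A′]|²`.  On that subspace `Δ_aA′ = ∂*∂A′` (`B5Hk163RDiv.DeltaA_mulVec_eq_DstarD_mulVec`,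
`a = 1`) and «Δ_a is a positive operator» (p. 30; tree `B5DeltaA169.DeltaA_posDef`).  Without `R∂*A′ = 0` this
fails (`A′ = ∂λ` with `Q_k∂λ = 0` has zero curvature) — the rôle of `δ_R(∂*A)` in (1.47).
[cite: Balaban1984PropagatorsI, (1.47) p.26; p.30 «At first let us prove that Δ_a is a positive operator»] -/
theorem cEnergy_pos_of_mem_Fib_zero (A' : Tor (fine n M) × Fin d → ℂ) (hA' : A' ∈ Fib n M 0)
    (hne : A' ≠ 0) : 0 < cEnergy n M A' := by
  have hn : 1 ≤ n := Nat.one_le_iff_ne_zero.mpr (NeZero.ne n)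
  have hz : star A' ⬝ᵥ (DeltaA n M 1 *ᵥ A') = star A' ⬝ᵥ (DstarD n M *ᵥ A') := by
    rw [DeltaA_mulVec_eq_DstarD_mulVec n M 1 A' hA'.1 hA'.2]
  have hpos := (DeltaA_posDef n hn M 1 one_pos).dotProduct_mulVec_pos hne
  rw [hz, form_eq_cEnergy] at hpos
  exact_mod_cast hpos

/-- on the gauge-fixed subspace `cEnergy A′ = 0 ↔ A′ = 0`. [cite: Balaban1984PropagatorsI, p.30 (text)] -/
theorem cEnergy_eq_zero_iff_of_mem_Fib_zero (A' : Tor (fine n M) × Fin d → ℂ) (hA' : A' ∈ Fib n M 0) :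
    cEnergy n M A' = 0 ↔ A' = 0 := by
  constructor
  · intro h
    by_contra hne
    exact (cEnergy_pos_of_mem_Fib_zero n M A' hA' hne).ne' h
  · rintro rfl
    exact cEnergy_zero n M

/-- hence `H_kB` is the UNIQUE point of the hyperplane of minimal energy, in `cEnergy` terms (tree
`B5Hk163RDiv.HkOp_minimum_unique`, restated). [cite: Balaban1984PropagatorsI, p.26 «minimizing the form
½⟨∂A, ∂A⟩ under the conditions Q_kA = B, R∂*A = 0»] -/
theorem eq_HkOp_of_cEnergy_le (B : Tor M × Fin d → ℂ) (A : Tor (fine n M) × Fin d → ℂ) (hA : A ∈ Fib n M B)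
    (hle : cEnergy n M A ≤ cEnergy n M (HkOp n M *ᵥ B)) : A = HkOp n M *ᵥ B :=
  B5Hk163RDiv.HkOp_minimum_unique n M B A hA.1 hA.2 hle

end Positivity

/-! ## §3  The δ-measure of the hyperplane and (1.64) -/

section Gauss

open Matrix

variable (n : ℕ) [NeZero n] (M : Fin d → ℕ) [hM : ∀ μ, NeZero (M μ)]
variable {W : Type*} (ι : W → (Tor (fine n M) × Fin d → ℂ))

/-- the integrand after the translation, pointwise: `exp(−c·cEnergy(ι w + H_kB)) =
exp(−c·cEnergy(H_kB)) · exp(−c·cEnergy(ι w))` (energy splitting, `Q_kι = 0`).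
[cite: Balaban1984PropagatorsI, p.29 (text)] -/
theorem integrand_transl (hι : ∀ w, QvOp n M *ᵥ ι w = 0) (c : ℝ) (B : Tor M × Fin d → ℂ) (w : W) :
    Real.exp (-(c * cEnergy n M (ι w + HkOp n M *ᵥ B)))
      = Real.exp (-(c * cEnergy n M (HkOp n M *ᵥ B))) * Real.exp (-(c * cEnergy n M (ι w))) := by
  rw [cEnergy_transl n M B (ι w) (hι w), ← Real.exp_add]
  congr 1
  ring

/-- the exponent of (1.64) is the MINIMUM of the exponent of (1.47) over the hyperplane: for every sample
`w`, `exp(−c·cEnergy(ι w + H_kB)) ≤ exp(−c·cEnergy(H_kB))` when `c ≥ 0`. [cite: Balaban1984PropagatorsI,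
p.26 (text), p.29 (text)] -/
theorem integrand_le (hι : ∀ w, QvOp n M *ᵥ ι w = 0) {c : ℝ} (hc : 0 ≤ c) (B : Tor M × Fin d → ℂ) (w : W) :
    Real.exp (-(c * cEnergy n M (ι w + HkOp n M *ᵥ B))) ≤ Real.exp (-(c * cEnergy n M (HkOp n M *ᵥ B))) := by
  apply Real.exp_le_exp.mpr
  have := cEnergy_HkOp_le n M B (ι w) (hι w)
  nlinarith

variable [MeasurableSpace W] (μ : Measure W)

/-- **the integral of (1.47), typed**: `∫dA δ(B − Q_kA)δ_R(∂*A) exp(−c⟨A, ∂*∂A⟩)` with the δ-measure of the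
hyperplane `{Q_kA = B, R∂*A = 0}` read (as B5 (1.40) reads `∫dλ δ(Q′_kλ)(…) = ∫_{N(Q′_k)}dλ(…)`, and as the tree's
`B9Eq320Gauss`) as the translate by `H_kB` of a measure `μ` on a parameter space `W` of the subspace
`{Q_kA′ = 0, R∂*A′ = 0}` («δ_R is a δ-function concentrated at the origin of the sub-space R», p. 25),
parametrised by `ι`; `c` absorbs the `½` and the (1.21) weight.
[cite: Balaban1984PropagatorsI, (1.47) p.26, (1.40)–(1.41) p.25, p.29 «We make the translation A = A′ + H_kB»] -/
def int147 (c : ℝ) (B : Tor M × Fin d → ℂ) : ℝ :=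
  ∫ w, Real.exp (-(c * cEnergy n M (ι w + HkOp n M *ᵥ B))) ∂μ

/-- the `B`-INDEPENDENT Gaussian factor of `Z_k`: `Zint := ∫ exp(−c⟨A′, ∂*∂A′⟩) dμ` over the subspace.
[cite: Balaban1984PropagatorsI, (1.64) p.29] -/
def Zint (c : ℝ) : ℝ :=
  ∫ w, Real.exp (-(c * cEnergy n M (ι w))) ∂μ

/-- unfolding lemma. [folklore] -/
theorem int147_apply (c : ℝ) (B : Tor M × Fin d → ℂ) :
    int147 n M ι μ c B = ∫ w, Real.exp (-(c * cEnergy n M (ι w + HkOp n M *ᵥ B))) ∂μ := rfl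

/-- unfolding lemma. [folklore] -/
theorem Zint_apply (c : ℝ) : Zint n M ι μ c = ∫ w, Real.exp (-(c * cEnergy n M (ι w))) ∂μ := rfl

/-- `Zint = int147 c 0` (the integral of (1.47) at `B = 0`). [folklore] -/
theorem int147_zero (c : ℝ) : int147 n M ι μ c 0 = Zint n M ι μ c := by
  simp [int147, Zint, Matrix.mulVec_zero]

/-- `0 ≤ int147`, `0 ≤ Zint` (integrals of positive functions; `= 0` exactly when Mathlib's `∫` meets a
non-integrable integrand or `μ = 0` — see §4 for the flat measure). [folklore] -/
theorem int147_nonneg (c : ℝ) (B : Tor M × Fin d → ℂ) : 0 ≤ int147 n M ι μ c B :=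
  integral_nonneg fun _ => (Real.exp_pos _).le

/-- `0 ≤ Zint`. [folklore] -/
theorem Zint_nonneg (c : ℝ) : 0 ≤ Zint n M ι μ c :=
  integral_nonneg fun _ => (Real.exp_pos _).le

/-- **(1.64): «((ST)^k e^{−S})(B) = Z_k exp(−½⟨∂H_kB, ∂H_kB⟩)»** — the integral of (1.47) FACTORISES:
`int147 c B = Zint c · exp(−c·cEnergy(H_kB))`, for every measure `μ`, every parametrisation `ι` of (part of)
`N(Q_k)`, every real `c`; no integrability is needed.
[cite: Balaban1984PropagatorsI, (1.64) p.29, (1.47) p.26] -/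
theorem int147_eq (hι : ∀ w, QvOp n M *ᵥ ι w = 0) (c : ℝ) (B : Tor M × Fin d → ℂ) :
    int147 n M ι μ c B = Zint n M ι μ c * Real.exp (-(c * cEnergy n M (HkOp n M *ᵥ B))) := by
  rw [int147, Zint]
  simp_rw [integrand_transl n M ι hι c B]
  rw [integral_const_mul, mul_comm]

/-- (1.64) with the printed exponent made explicit: `int147 c B = Zint c · exp(−c·½Σ_{x,μ,ν}|F_{μν}[H_kB](x)|²)`
((1.65) «⟨B, Δ_kB⟩ = ⟨∂H_kB, ∂H_kB⟩» is this exponent; its momentum form (1.66) is `B5Hk163Form166`).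
[cite: Balaban1984PropagatorsI, (1.64)–(1.65) p.29, (1.21) p.21] -/
theorem int147_eq_curvature (hι : ∀ w, QvOp n M *ᵥ ι w = 0) (c : ℝ) (B : Tor M × Fin d → ℂ) :
    int147 n M ι μ c B
      = Zint n M ι μ c
          * Real.exp (-(c * ((1 / 2 : ℝ) * ∑ x, ∑ μ, ∑ ν, ‖Fs (fine n M) (n : ℂ) (HkOp n M *ᵥ B) μ ν x‖ ^ 2))) := by
  rw [int147_eq n M ι μ hι, cEnergy_eq]

/-- **(1.47) = (1.64) with the free prefactor**: `z′^{(k)}∣det(Δ↾_{N(Q_k)})∣·∫(…) = Z_k·exp(−c·cEnergy(H_kB))` with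
`Z_k := z′^{(k)}∣det(Δ↾_{N(Q_k)})∣·Zint` — a number independent of `B`.
[cite: Balaban1984PropagatorsI, (1.47) p.26, (1.64) p.29] -/
theorem rt147_eq_164 (hι : ∀ w, QvOp n M *ᵥ ι w = 0) (pref c : ℝ) :
    ∃ Zk : ℝ, ∀ B : Tor M × Fin d → ℂ,
      pref * int147 n M ι μ c B = Zk * Real.exp (-(c * cEnergy n M (HkOp n M *ᵥ B))) :=
  ⟨pref * Zint n M ι μ c, fun B => by rw [int147_eq n M ι μ hι, mul_assoc]⟩

/-- **BASE-POINT INDEPENDENCE of the typing**: with `μ` right-translation-invariant and `ι` additive,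
translating by ANY point `A₀` of the hyperplane whose difference with `H_kB` is parametrised (`ι w₁ = A₀ − H_kB`)
gives the same integral as translating by `H_kB`. [folklore] -/
theorem int147_base_indep {W : Type*} [MeasurableSpace W] [AddGroup W] [MeasurableAdd W] (μ : Measure W)
    [μ.IsAddRightInvariant] (ι : W →+ (Tor (fine n M) × Fin d → ℂ)) (c : ℝ) (B : Tor M × Fin d → ℂ)
    (A₀ : Tor (fine n M) × Fin d → ℂ) (w₁ : W) (hw₁ : ι w₁ = A₀ - HkOp n M *ᵥ B) :
    ∫ w, Real.exp (-(c * cEnergy n M (ι w + A₀))) ∂μ = int147 n M ι μ c B := by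
  have hA₀ : A₀ = ι w₁ + HkOp n M *ᵥ B := by rw [hw₁, sub_add_cancel]
  have key : ∀ w, (ι : W → _) w + A₀ = ι (w + w₁) + HkOp n M *ᵥ B := by
    intro w
    rw [hA₀, map_add, add_assoc]
  simp_rw [key]
  rw [int147]
  exact integral_add_right_eq_self (μ := μ)
    (fun w => Real.exp (-(c * cEnergy n M ((ι : W → _) w + HkOp n M *ᵥ B)))) w₁

end Gauss

/-! ## §4  Convergence for the flat measure: `0 < Z_k < ∞` -/

section Convergence

open Matrix

variable (n : ℕ) [NeZero n] (M : Fin d → ℕ) [hM : ∀ μ, NeZero (M μ)]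
variable {m : ℕ} (ι : EuclideanSpace ℝ (Fin m) →ₗ[ℝ] (Tor (fine n M) × Fin d → ℂ))

/-- `w ↦ cEnergy (ι w)` is continuous (a quadratic polynomial in the coordinates). [folklore] -/
theorem continuous_cEnergy_comp : Continuous fun w => cEnergy n M (ι w) := by
  have hι : Continuous fun w => ι w := ι.continuous_of_finiteDimensional
  unfold cEnergy
  refine Complex.continuous_re.comp ?_
  exact (continuous_star.comp hι).dotProduct (continuous_const.matrix_mulVec hι)

/-- **coercivity**: for an injective linear parametrisation of (part of) the gauge-fixed subspace there is
`m₀ > 0` with `m₀‖w‖² ≤ cEnergy (ι w)` (§2 + compactness of the unit sphere + homogeneity). [folklore] -/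
theorem exists_sq_norm_le_cEnergy (hι0 : ∀ w, ι w ∈ Fib n M 0) (hinj : Function.Injective ι) :
    ∃ m₀ : ℝ, 0 < m₀ ∧ ∀ w, m₀ * ‖w‖ ^ 2 ≤ cEnergy n M (ι w) := by
  classical
  set q : EuclideanSpace ℝ (Fin m) → ℝ := fun w => cEnergy n M (ι w) with hq
  have hqc : Continuous q := continuous_cEnergy_comp n M ι
  have hq0 : q 0 = 0 := by simp [hq]
  have hqpos : ∀ w, w ≠ 0 → 0 < q w := by
    intro w hw
    have hne : ι w ≠ 0 := by
      intro h
      apply hw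
      apply hinj
      rw [h, map_zero]
    exact cEnergy_pos_of_mem_Fib_zero n M (ι w) (hι0 w) hne
  have hhom : ∀ (t : ℝ) w, q (t • w) = t ^ 2 * q w := by
    intro t w
    simp only [hq, map_smul]
    exact cEnergy_smul n M t (ι w)
  by_cases hS : (Metric.sphere (0 : EuclideanSpace ℝ (Fin m)) 1).Nonempty
  · obtain ⟨u₀, hu₀, hmin⟩ :=
      (isCompact_sphere (0 : EuclideanSpace ℝ (Fin m)) 1).exists_isMinOn hS hqc.continuousOn
    have hu₀ne : u₀ ≠ 0 := by
      intro h
      rw [h, Metric.mem_sphere, dist_self] at hu₀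
      exact zero_ne_one hu₀
    refine ⟨q u₀, hqpos u₀ hu₀ne, fun w => ?_⟩
    by_cases hw : w = 0
    · subst hw
      simp
    · have hnorm : ‖w‖ ≠ 0 := norm_ne_zero_iff.mpr hw
      set u := (‖w‖⁻¹ : ℝ) • w with hu
      have hu1 : u ∈ Metric.sphere (0 : EuclideanSpace ℝ (Fin m)) 1 := by
        rw [mem_sphere_zero_iff_norm, hu, norm_smul, norm_inv, norm_norm, inv_mul_cancel₀ hnorm]
      have hwu : w = ‖w‖ • u := by
        rw [hu, smul_smul, mul_inv_cancel₀ hnorm, one_smul]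
      have hle : q u₀ ≤ q u := hmin hu1
      calc q u₀ * ‖w‖ ^ 2 ≤ q u * ‖w‖ ^ 2 := by
            exact mul_le_mul_of_nonneg_right hle (sq_nonneg _)
        _ = q w := by
            conv_rhs => rw [hwu, hhom]
            exact mul_comm _ _
  · refine ⟨1, one_pos, fun w => ?_⟩
    have hw : w = 0 := by
      by_contra hw
      apply hS
      refine ⟨(‖w‖⁻¹ : ℝ) • w, ?_⟩
      rw [mem_sphere_zero_iff_norm, norm_smul, norm_inv, norm_norm,
        inv_mul_cancel₀ (norm_ne_zero_iff.mpr hw)]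
    subst hw
    simp

/-- **INTEGRABILITY of the gauge-fixed Gaussian** for the flat measure: `c > 0`, `ι` injective into
`{Q_kA′ = 0, R∂*A′ = 0}` ⇒ `w ↦ exp(−c·cEnergy(ι w))` is `volume`-integrable on the Euclidean parameter space.
[folklore] -/
theorem integrable_gauss (hι0 : ∀ w, ι w ∈ Fib n M 0) (hinj : Function.Injective ι) {c : ℝ} (hc : 0 < c) :
    Integrable (fun w => Real.exp (-(c * cEnergy n M (ι w)))) := by
  obtain ⟨m₀, hm₀, hle⟩ := exists_sq_norm_le_cEnergy n M ι hι0 hinj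
  have hb : 0 < c * m₀ := mul_pos hc hm₀
  have hg : Integrable (fun w : EuclideanSpace ℝ (Fin m) => Real.exp (-(c * m₀) * ‖w‖ ^ 2)) := by
    apply Integrable.of_integral_ne_zero
    rw [GaussianFourier.integral_rexp_neg_mul_sq_norm hb]
    positivity
  refine hg.mono' ?_ ?_
  · exact (Real.continuous_exp.comp ((continuous_cEnergy_comp n M ι).const_mul c).neg).aestronglyMeasurable
  · refine Filter.Eventually.of_forall fun w => ?_
    rw [Real.norm_eq_abs, abs_of_pos (Real.exp_pos _)]
    apply Real.exp_le_exp.mpr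
    have := hle w
    nlinarith

/-- **`0 < Zint` for the flat measure** (finite and non-zero: the Gaussian factor of `Z_k` in (1.64)).
[cite: Balaban1984PropagatorsI, (1.64) p.29] -/
theorem Zint_pos (hι0 : ∀ w, ι w ∈ Fib n M 0) (hinj : Function.Injective ι) {c : ℝ} (hc : 0 < c) :
    0 < Zint n M ι volume c := by
  rw [Zint]
  exact integral_exp_pos (integrable_gauss n M ι hι0 hinj hc)

/-- **`0 < (1.47)` for the flat measure**, every `B`. [cite: Balaban1984PropagatorsI, (1.47) p.26, (1.64) p.29] -/
theorem int147_pos (hι0 : ∀ w, ι w ∈ Fib n M 0) (hinj : Function.Injective ι) {c : ℝ} (hc : 0 < c)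
    (B : Tor M × Fin d → ℂ) : 0 < int147 n M ι volume c B := by
  rw [int147_eq n M ι volume (fun w => (hι0 w).1) c B]
  exact mul_pos (Zint_pos n M ι hι0 hinj hc) (Real.exp_pos _)

/-- and the translated integrand is integrable too (so (1.64) is an identity of CONVERGENT integrals for the
flat measure). [folklore] -/
theorem integrable_int147 (hι0 : ∀ w, ι w ∈ Fib n M 0) (hinj : Function.Injective ι) {c : ℝ} (hc : 0 < c)
    (B : Tor M × Fin d → ℂ) :
    Integrable (fun w => Real.exp (-(c * cEnergy n M (ι w + HkOp n M *ᵥ B)))) := by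
  simp_rw [integrand_transl n M ι (fun w => (hι0 w).1) c B]
  exact (integrable_gauss n M ι hι0 hinj hc).const_mul _

end Convergence

/-! ## §5  (1.68)/(1.69) (v1.1): «The additional terms vanish because of the delta-functions» and the
quadratic form `⟨A, Δ_aA⟩`

p. 29 [PDF 13], bottom (render `…-p013-x2.png`, read as image): «E. Operators G
The integral (1.47) can be written in the following way
((ST)^k exp(−S))(B) = z′^{(k)}∣det(Δ↾_{N(Q_k)})∣∫dAδ(B − Q_kA)δ_R(∂*A)
·exp[−½⟨∂A, ∂A⟩ − ½‖R∂*A‖² − ½a‖B − Q_kA‖²].  (1.68)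
The additional terms vanish because of the delta-functions. The quadratic form in the fields A in the
exponential is equal to
⟨A, Δ_aA⟩ = ⟨A, ∂*∂A⟩ + ⟨A, ∂R∂*A⟩ + a⟨A, Q*QA⟩ = ⟨A, ΔA⟩ − ⟨A, ∂P∂*A⟩ + a⟨A, Q*QA⟩,  (1.69)
Δ = ∂*∂ + ∂∂*, R = I − P,».

Typing (as in §1–§3: torus model, UNWEIGHTED sums).  With the tree's `Q*_k = η^{−d}(Q_k)ᴴ`
(`B5DeltaA169.QvAdj`, `η^{−d} = n^d`) the three terms of the (1.68) exponent carry the common factor `½η^d`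
relative to the unweighted sums used here, so the typed exponent is `−c·E168 a B A` with
`E168 a B A := cEnergy A + Σ_x|((I − P)∂*A)(x)|² + a·n^d·Σ_y|(B − Q_kA)(y)|²` and a free real `c`; the typed
`Δ_a` is the tree's `B5DeltaA169.DeltaA n M a = Δ − ∂P∂* + aQ*Q` ((1.69) second line = its definition,
`B5DeltaA169.DeltaA_mulVec`). -/

section Aux168

open Matrix
open scoped ComplexOrder

variable (n : ℕ) [NeZero n] (M : Fin d → ℕ) [hM : ∀ μ, NeZero (M μ)]

/-- the typed `R∂*A = (I − P)∂*A` («R = I − P», (1.69)), so that `Fib B = {A : Q_kA = B ∧ RdivS A = 0}`.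
[cite: Balaban1984PropagatorsI, (1.69) p.29] -/
def RdivS (A : Tor (fine n M) × Fin d → ℂ) : Tor (fine n M) → ℂ :=
  (1 - PcT n M (n : ℂ)) *ᵥ ((GradOp (fine n M) (n : ℂ))ᴴ *ᵥ A)

/-- unfolding. [folklore] -/
theorem RdivS_apply (A : Tor (fine n M) × Fin d → ℂ) :
    RdivS n M A = (1 - PcT n M (n : ℂ)) *ᵥ ((GradOp (fine n M) (n : ℂ))ᴴ *ᵥ A) := rfl

/-- on the hyperplane `R∂*A = 0`. [cite: Balaban1984PropagatorsI, (1.47) p.26] -/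
theorem RdivS_eq_zero_of_mem_Fib {B : Tor M × Fin d → ℂ} {A : Tor (fine n M) × Fin d → ℂ}
    (hA : A ∈ Fib n M B) : RdivS n M A = 0 :=
  hA.2

/-- moving a matrix across the sesquilinear pairing: `uᴴ·(Pv) = (Pᴴu)ᴴ·v`. [folklore] -/
theorem star_dotProduct_mulVec_eq {m k : Type*} [Fintype m] [Fintype k] (P : Matrix m k ℂ)
    (u : m → ℂ) (v : k → ℂ) : star u ⬝ᵥ (P *ᵥ v) = star (Pᴴ *ᵥ u) ⬝ᵥ v := by
  rw [Matrix.dotProduct_mulVec, Matrix.star_mulVec, Matrix.conjTranspose_conjTranspose]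

/-- **the (1.68) exponent**, typed (up to the factor `−½η^d`, see the § header):
`E168 a B A = cEnergy A + Σ_x|(R∂*A)(x)|² + a·n^d·Σ_y|(B − Q_kA)(y)|²`.
[cite: Balaban1984PropagatorsI, (1.68) p.29] -/
def E168 (a : ℝ) (B : Tor M × Fin d → ℂ) (A : Tor (fine n M) × Fin d → ℂ) : ℝ :=
  cEnergy n M A + ∑ x, ‖RdivS n M A x‖ ^ 2
    + a * (n : ℝ) ^ d * ∑ y, ‖(B - QvOp n M *ᵥ A) y‖ ^ 2

/-- for `a ≥ 0` the additional terms are non-negative: `cEnergy A ≤ E168 a B A`. [folklore] -/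
theorem cEnergy_le_E168 {a : ℝ} (ha : 0 ≤ a) (B : Tor M × Fin d → ℂ) (A : Tor (fine n M) × Fin d → ℂ) :
    cEnergy n M A ≤ E168 n M a B A := by
  unfold E168
  have h1 : 0 ≤ ∑ x, ‖RdivS n M A x‖ ^ 2 := by positivity
  have h2 : 0 ≤ a * (n : ℝ) ^ d * ∑ y, ‖(B - QvOp n M *ᵥ A) y‖ ^ 2 := by positivity
  linarith

/-- **«The additional terms vanish because of the delta-functions»**: on the hyperplane
`{A : Q_kA = B, R∂*A = 0}` the (1.68) exponent IS the (1.47) exponent, for every `a`.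
[cite: Balaban1984PropagatorsI, p.29 (text after (1.68))] -/
theorem E168_eq_cEnergy_of_mem_Fib (a : ℝ) {B : Tor M × Fin d → ℂ} {A : Tor (fine n M) × Fin d → ℂ}
    (hA : A ∈ Fib n M B) : E168 n M a B A = cEnergy n M A := by
  have hR : RdivS n M A = 0 := hA.2
  have hQ : B - QvOp n M *ᵥ A = 0 := by rw [hA.1, sub_self]
  rw [E168, hR, hQ]
  simp

/-- in particular at `A = H_kB`. [cite: Balaban1984PropagatorsI, p.29 (text)] -/
theorem E168_HkOp (a : ℝ) (B : Tor M × Fin d → ℂ) :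
    E168 n M a B (HkOp n M *ᵥ B) = cEnergy n M (HkOp n M *ᵥ B) :=
  E168_eq_cEnergy_of_mem_Fib n M a (HkOp_mem_Fib n M B)

/-- after the translation `A = A′ + H_kB`, `A′ ∈ {Q_kA′ = 0, R∂*A′ = 0}`: the (1.68) exponent splits as
`cEnergy A′ + cEnergy (H_kB)` (§1 `cEnergy_transl`). [cite: Balaban1984PropagatorsI, p.29 (text)] -/
theorem E168_transl (a : ℝ) (B : Tor M × Fin d → ℂ) (A' : Tor (fine n M) × Fin d → ℂ)
    (hA' : A' ∈ Fib n M 0) :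
    E168 n M a B (A' + HkOp n M *ᵥ B) = cEnergy n M A' + cEnergy n M (HkOp n M *ᵥ B) := by
  rw [E168_eq_cEnergy_of_mem_Fib n M a ((add_HkOp_mem_Fib_iff n M B A').2 hA'),
    cEnergy_transl n M B A' hA'.1]

/-- **(1.68) = (1.47) as typed integrals**: for a parametrisation `ι` INTO the gauge-fixed subspace
`{Q_kA′ = 0, R∂*A′ = 0}` (the printed δ-measure, §3) the (1.68) integrand and the (1.47) integrand agree
pointwise, hence the integrals agree — for every measure `μ`, every `a`, every `c`.
[cite: Balaban1984PropagatorsI, (1.68) p.29 «The integral (1.47) can be written in the following way»] -/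
theorem int168_eq_int147 {W : Type*} [MeasurableSpace W] (μ : Measure W)
    (ι : W → (Tor (fine n M) × Fin d → ℂ)) (hι0 : ∀ w, ι w ∈ Fib n M 0) (c a : ℝ)
    (B : Tor M × Fin d → ℂ) :
    ∫ w, Real.exp (-(c * E168 n M a B (ι w + HkOp n M *ᵥ B))) ∂μ = int147 n M ι μ c B := by
  have h : ∀ w, E168 n M a B (ι w + HkOp n M *ᵥ B) = cEnergy n M (ι w + HkOp n M *ᵥ B) := fun w =>
    E168_eq_cEnergy_of_mem_Fib n M a ((add_HkOp_mem_Fib_iff n M B (ι w)).2 (hι0 w))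
  simp_rw [h, int147_apply]

/-- **(1.68) ⟹ (1.64)**: the (1.68) integral equals `Zint·exp(−c·cEnergy(H_kB))` (§3 `int147_eq`).
[cite: Balaban1984PropagatorsI, (1.68) p.29, (1.64) p.29] -/
theorem int168_eq_164 {W : Type*} [MeasurableSpace W] (μ : Measure W)
    (ι : W → (Tor (fine n M) × Fin d → ℂ)) (hι0 : ∀ w, ι w ∈ Fib n M 0) (c a : ℝ)
    (B : Tor M × Fin d → ℂ) :
    ∫ w, Real.exp (-(c * E168 n M a B (ι w + HkOp n M *ᵥ B))) ∂μ
      = Zint n M ι μ c * Real.exp (-(c * cEnergy n M (HkOp n M *ᵥ B))) := by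
  rw [int168_eq_int147 n M μ ι hι0 c a B, int147_eq n M ι μ (fun w => (hι0 w).1) c B]

/-- `R = I − P` is an orthogonal projection: `RᴴR = R` (tree `B5Value126.PcT_conjTranspose`,
`PcT_mul_PcT`; the separate identities `Rᴴ = R`, `R² = R` are the tree's
`Beta.BlockEffectiveAction.R_conjTranspose` / `R_mul_R`, not imported here to keep the Sect. D chain free of the
β sub-cell's modules). [cite: Balaban1984PropagatorsI, (1.69) p.29 «R = I − P»; p.25 «R is an orthogonal
projection»] -/
theorem R_conjTranspose_mul_R :
    (1 - PcT n M (n : ℂ))ᴴ * (1 - PcT n M (n : ℂ)) = 1 - PcT n M (n : ℂ) := by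
  have hc : (n : ℂ) ≠ 0 := Nat.cast_ne_zero.mpr (NeZero.ne n)
  rw [Matrix.conjTranspose_sub, Matrix.conjTranspose_one, B5Value126.PcT_conjTranspose, Matrix.sub_mul,
    Matrix.one_mul, Matrix.mul_sub, Matrix.mul_one, B5Value126.PcT_mul_PcT n M (n : ℂ) hc, sub_self,
    sub_zero]

/-- the middle term of (1.69): `⟨A, ∂R∂*A⟩ = ⟨R∂*A, R∂*A⟩ = ‖R∂*A‖²` (`R` an orthogonal projection).
[cite: Balaban1984PropagatorsI, (1.68)/(1.69) p.29] -/
theorem form_dRd (A : Tor (fine n M) × Fin d → ℂ) :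
    star A ⬝ᵥ (GradOp (fine n M) (n : ℂ) *ᵥ RdivS n M A) = star (RdivS n M A) ⬝ᵥ RdivS n M A := by
  unfold RdivS
  rw [star_dotProduct_mulVec_eq]
  conv_lhs => rw [← R_conjTranspose_mul_R n M, ← Matrix.mulVec_mulVec]
  rw [star_dotProduct_mulVec_eq, Matrix.conjTranspose_conjTranspose]

/-- **(1.69), first line, as an identity of FORMS**: `Aᴴ·Δ_aA = Aᴴ·∂*∂A + (R∂*A)ᴴ·(R∂*A) + a·n^d·(Q_kA)ᴴ·(Q_kA)`
(`Δ_a = B5DeltaA169.DeltaA`, `∂*∂ = B5Hk163RDiv.DstarD`, `Q*_k = n^d(Q_k)ᴴ`).  At OPERATOR level (1.69) is the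
tree's `B5DeltaA169.DeltaA_eq_curl` (and the β sub-cell's `Beta.BlockEffectiveAction.DeltaA_eq_Kop_add`); what
(1.68) needs is this form version with the squared norm `‖R∂*A‖²`.
[cite: Balaban1984PropagatorsI, (1.69) p.29] -/
theorem form_DeltaA_169 (a : ℝ) (A : Tor (fine n M) × Fin d → ℂ) :
    star A ⬝ᵥ (DeltaA n M a *ᵥ A)
      = star A ⬝ᵥ (DstarD n M *ᵥ A) + star (RdivS n M A) ⬝ᵥ RdivS n M A
        + ((a : ℂ) * (n : ℂ) ^ d) * (star (QvOp n M *ᵥ A) ⬝ᵥ (QvOp n M *ᵥ A)) := by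
  have hΔ : DeltaA n M a *ᵥ A
      = DstarD n M *ᵥ A + GradOp (fine n M) (n : ℂ) *ᵥ RdivS n M A
        + ((a : ℂ) * (n : ℂ) ^ d) • ((QvOp n M)ᴴ *ᵥ (QvOp n M *ᵥ A)) := by
    simp only [B5DeltaA169.DeltaA_mulVec, DstarD, RdivS, Matrix.sub_mulVec, Matrix.one_mulVec,
      Matrix.mulVec_sub, ← Matrix.mulVec_mulVec]
    abel
  rw [hΔ, dotProduct_add, dotProduct_add, form_dRd, dotProduct_smul,
    star_dotProduct_mulVec_eq ((QvOp n M)ᴴ) A (QvOp n M *ᵥ A), Matrix.conjTranspose_conjTranspose,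
    smul_eq_mul]

/-- (1.69) in real terms: `Re⟨A, Δ_aA⟩ = cEnergy A + Σ_x|(R∂*A)(x)|² + a·n^d·Σ_y|(Q_kA)(y)|²`.
[cite: Balaban1984PropagatorsI, (1.69) p.29] -/
theorem re_form_DeltaA (a : ℝ) (A : Tor (fine n M) × Fin d → ℂ) :
    (star A ⬝ᵥ (DeltaA n M a *ᵥ A)).re
      = cEnergy n M A + ∑ x, ‖RdivS n M A x‖ ^ 2 + a * (n : ℝ) ^ d * ∑ y, ‖(QvOp n M *ᵥ A) y‖ ^ 2 := by
  have sds : ∀ {κ : Type} [Fintype κ] (v : κ → ℂ), star v ⬝ᵥ v = ((∑ i, ‖v i‖ ^ 2 : ℝ) : ℂ) := by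
    intro κ _ v
    simp only [dotProduct, Pi.star_apply, Complex.star_def, Complex.conj_mul', Complex.ofReal_sum,
      Complex.ofReal_pow]
  have h := form_DeltaA_169 n M a A
  rw [form_eq_cEnergy, sds, sds] at h
  have hc : star A ⬝ᵥ (DeltaA n M a *ᵥ A)
      = ((cEnergy n M A + ∑ x, ‖RdivS n M A x‖ ^ 2
          + a * (n : ℝ) ^ d * ∑ y, ‖(QvOp n M *ᵥ A) y‖ ^ 2 : ℝ) : ℂ) := by
    rw [h]
    push_cast
    ring
  rw [hc, Complex.ofReal_re]

/-- expanding `‖B − v‖²`. [folklore] -/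
theorem sum_norm_sq_sub {ι : Type*} [Fintype ι] (B v : ι → ℂ) :
    ∑ y, ‖(B - v) y‖ ^ 2 = ∑ y, ‖B y‖ ^ 2 - 2 * (star B ⬝ᵥ v).re + ∑ y, ‖v y‖ ^ 2 := by
  have sds : ∀ w : ι → ℂ, star w ⬝ᵥ w = ((∑ i, ‖w i‖ ^ 2 : ℝ) : ℂ) := fun w => by
    simp only [dotProduct, Pi.star_apply, Complex.star_def, Complex.conj_mul', Complex.ofReal_sum,
      Complex.ofReal_pow]
  have h : ((∑ y, ‖(B - v) y‖ ^ 2 : ℝ) : ℂ)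
      = ((∑ y, ‖B y‖ ^ 2 : ℝ) : ℂ) - (star B ⬝ᵥ v + star (star B ⬝ᵥ v))
        + ((∑ y, ‖v y‖ ^ 2 : ℝ) : ℂ) := by
    rw [← sds, ← sds, ← sds, star_sub,
      sub_dotProduct, dotProduct_sub, dotProduct_sub, ← Matrix.star_dotProduct]
    ring
  have h2 := congrArg Complex.re h
  simp only [Complex.ofReal_re, Complex.add_re, Complex.sub_re, Complex.star_def, Complex.conj_re] at h2
  rw [h2]
  ring

/-- **«The quadratic form in the fields A in the exponential is equal to ⟨A, Δ_aA⟩»**: the typed (1.68)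
exponent is `Re⟨A, Δ_aA⟩` plus the terms linear and constant in `A`:
`E168 a B A = Re⟨A, Δ_aA⟩ − 2a·n^d·Re⟨B, Q_kA⟩ + a·n^d·Σ_y|B(y)|²`.
[cite: Balaban1984PropagatorsI, (1.68)/(1.69) p.29] -/
theorem E168_eq_form_DeltaA (a : ℝ) (B : Tor M × Fin d → ℂ) (A : Tor (fine n M) × Fin d → ℂ) :
    E168 n M a B A
      = (star A ⬝ᵥ (DeltaA n M a *ᵥ A)).re
        - 2 * (a * (n : ℝ) ^ d) * (star B ⬝ᵥ (QvOp n M *ᵥ A)).re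
        + a * (n : ℝ) ^ d * ∑ y, ‖B y‖ ^ 2 := by
  rw [re_form_DeltaA, E168, sum_norm_sq_sub]
  ring

/-- and that quadratic form is POSITIVE DEFINITE on ALL fine fields (no constraint): `A ≠ 0 → 0 < Re⟨A, Δ_aA⟩`
for `a > 0` — «Δ_a is a positive operator» (p. 30), tree `B5DeltaA169.DeltaA_posDef`; this is what makes the
(1.68) form of the integral usable without the δ-functions in Sect. E.
[cite: Balaban1984PropagatorsI, p.30 «At first let us prove that Δ_a is a positive operator»] -/
theorem re_form_DeltaA_pos {a : ℝ} (ha : 0 < a) {A : Tor (fine n M) × Fin d → ℂ} (hA : A ≠ 0) :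
    0 < (star A ⬝ᵥ (DeltaA n M a *ᵥ A)).re := by
  have hn : 1 ≤ n := Nat.one_le_iff_ne_zero.mpr (NeZero.ne n)
  have hpos := (DeltaA_posDef n hn M a ha).dotProduct_mulVec_pos hA
  have h1 := (Complex.lt_def.mp hpos).1
  simpa using h1

/-- hence a lower bound of the (1.68) exponent by the unconstrained positive form: for `a ≥ 0`,
`cEnergy A + Σ|R∂*A|² ≤ E168 a B A`, and `cEnergy A + Σ|R∂*A|² = Re⟨A, Δ_0A⟩`-part is `> 0` off `A = 0`
only together with the `Q_k`-term — recorded as the inequality `E168 a B A ≥ Re⟨A, Δ_aA⟩ − 2a·n^d·Re⟨B, Q_kA⟩`.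
[folklore] -/
theorem re_form_DeltaA_sub_le_E168 {a : ℝ} (ha : 0 ≤ a) (B : Tor M × Fin d → ℂ)
    (A : Tor (fine n M) × Fin d → ℂ) :
    (star A ⬝ᵥ (DeltaA n M a *ᵥ A)).re - 2 * (a * (n : ℝ) ^ d) * (star B ⬝ᵥ (QvOp n M *ᵥ A)).re
      ≤ E168 n M a B A := by
  rw [E168_eq_form_DeltaA]
  have h : 0 ≤ a * (n : ℝ) ^ d * ∑ y, ‖B y‖ ^ 2 := by positivity
  linarith

end Aux168

end

end Literature.MathematicalPhysics.QuantumFieldTheory.Balaban1983to89.B5Hk164Transl
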